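import Summits.HodgeConjecture.CorCM.Census.CyclicBoundaryDescent
import Summits.HodgeConjecture.CorCM.Census.CyclicTypeBoundary
import Summits.HodgeConjecture.CorCM.Census.CoinvariantFloor

/-!
# Boundary sets of cyclic CM types, IV: descent and residue in `ℤ[CMF G c]` along a generator

COR-CM (cell `pub-hodgecm2`), count-neutral kernel combinatorics by the binder seat b23 (gen 38; lane CYCLIC-FACES, part IV, sequel of
`Census/CyclicBoundaryWindows` / `…Slide` / `…Descent` (parts I–II, the boundary-set descent) and `Census/CyclicTypeBoundary` (part III, the
dictionary); the main theorem is assembled in part V `Census/CyclicFacesGenerate.lean`).  Theorems only, in seat b09's intrinsic model (`CMF G c`, `rt`, `oflipCM`, `gface`/`gfaceSet`, `pair`/`pairSet`, `translates`,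
`hodgeSpan`, `Block`, `fibreTwo`, `Census/BlockParity*.lean`, `Census/Coinvariant*.lean` — consumed BY NAME, nothing restated); no
certificate, no `decide` table, no named fact, no geometry, no `sorry`.
HONEST FRAMING: `HC_CM` is NOT proved, here or anywhere in the tree; nothing here is a period or a headline.

CONTENT (`G` generated by `g` of order `2n`, `c = gⁿ`; `bd` the boundary set of part III, `pot` the potential of part I).
* §1 **`exists_gface`**: every type `Ψ` whose boundary set is not a singleton has a face relation `gface Ψ t t'` whose three other corners
  have boundary sets of smaller potential (part II `CyclicBoundary.exists_places` read through `bd_oflipCM`); hence some type has a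
  singleton boundary set (`exists_card_bd_eq_one`).
* §2 **DESCENT** (`clear_step`, `descent`): modulo any submodule `L` holding such a relation through every non-singleton type, every vector
  of `ℤ[CMF G c]` is congruent to one supported on singleton-boundary types.
* §3 **RESIDUE** (`mem_span_pairSet_of_card_bd_eq_one`): a vector with constant type sum (a Hodge vector) supported on singleton-boundary
  types is a sum of pairs — compare the type sums at `g^j` and `g^{j+1}` across the unique boundary `j` of a type in the support: only that
  type and its conjugate see it (`eq_or_eq_rt_of_bd_eq`), so their coefficients agree and the pair can be peeled off.
All [folklore] bookkeeping over [Pohlmann1968, Thm 1] in the reading of [Milne1999, Prop. 2.1].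

## References
* [Pohlmann1968] H. Pohlmann, Algebraic cycles on abelian varieties of complex multiplication type, Ann. of Math. 88 (1968), Thm 1.
* [Milne1999] J. S. Milne, Lefschetz motives and the Tate conjecture, Compositio Math. 117 (1999), Prop. 2.1, p. 54.
-/

namespace Summit.HodgeConjecture.CorCM.Census.CyclicFaces

open Finset
open scoped symmDiff
open Summit.HodgeConjecture.CorCM.Prior.AllgGroup.RfwfAllgGroup
open Summit.HodgeConjecture.CorCM.Census.BlockParity
open Summit.HodgeConjecture.CorCM.Census.Coinvariant
open Summit.HodgeConjecture.CorCM.Census.CyclicBoundary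

noncomputable section

variable {G : Type*} [Group G] [Fintype G] [DecidableEq G] (c : G) (g : G) {n : ℕ}

/-! ## §1 A potential-lowering face relation through every non-singleton type -/

section Generator

variable [NeZero n]

/-- **Every type whose boundary set is not a singleton has a face relation lowering the potential at its three other corners.**
[folklore] -/
theorem exists_gface (hc2 : c * c = 1) (hgn : g ^ n = c) (hord : orderOf g = 2 * n) (Ψ : CMF G c)
    (h1 : (bd c g n Ψ).card ≠ 1) :
    ∃ t t' : G, t' ∉ orb c t ∧
      pot (bd c g n (oflipCM c hc2 t Ψ)) < pot (bd c g n Ψ) ∧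
      pot (bd c g n (oflipCM c hc2 t' Ψ)) < pot (bd c g n Ψ) ∧
      pot (bd c g n (oflipCM c hc2 t (oflipCM c hc2 t' Ψ))) < pot (bd c g n Ψ) := by
  have h3 := three_le_card_bd c g hgn Ψ h1
  have hn : 2 ≤ n := le_trans (by norm_num) (three_le_of_card h3)
  obtain ⟨p, q, hpq, hp, hq, hpq'⟩ := exists_places (bd c g n Ψ) h3
  have hbp := bd_oflipCM c g hgn hc2 hord hn p.val
  have hbq := bd_oflipCM c g hgn hc2 hord hn q.val
  simp only [ZMod.natCast_zmod_val] at hbp hbq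
  refine ⟨g ^ p.val, g ^ q.val, ?_, ?_, ?_, ?_⟩
  · rw [pow_mem_orb_iff c g hgn hc2 hord, ZMod.natCast_zmod_val, ZMod.natCast_zmod_val]
    exact fun h => hpq h.symm
  · rw [hbp]; exact hp
  · rw [hbq]; exact hq
  · rw [hbp, hbq, symmDiff_right_comm]; exact hpq'

/-- **Some type has a singleton boundary set** (descend from any type along §1). [folklore] -/
theorem exists_card_bd_eq_one (hc2 : c * c = 1) (hc1 : c ≠ 1) (hgn : g ^ n = c) (hord : orderOf g = 2 * n) :
    ∃ Ψ : CMF G c, (bd c g n Ψ).card = 1 := by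
  obtain ⟨Φ, hΦ⟩ := exists_isCMF c hc2 hc1
  suffices h : ∀ K : ℕ, ∀ Ψ : CMF G c, pot (bd c g n Ψ) < K → ∃ Ψ' : CMF G c, (bd c g n Ψ').card = 1 from
    h _ ⟨Φ, hΦ⟩ (Nat.lt_succ_self _)
  intro K
  induction K with
  | zero => intro Ψ h; omega
  | succ K ih =>
    intro Ψ hK
    by_cases h1 : (bd c g n Ψ).card = 1
    · exact ⟨Ψ, h1⟩
    · obtain ⟨t, -, -, hp, -, -⟩ := exists_gface c g hc2 hgn hord Ψ h1
      exact ih (oflipCM c hc2 t Ψ) (by omega)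

/-! ## §2 The descent -/

/-- One clearing step: modulo a submodule `L` holding a potential-lowering face relation through every non-singleton type, a vector
whose non-singleton support has potential `< k + 1` is congruent to one whose non-singleton support has potential `< k`. [folklore] -/
theorem clear_step (hc2 : c * c = 1) (L : Submodule ℤ (CMF G c →₀ ℤ))
    (hL : ∀ Ψ : CMF G c, (bd c g n Ψ).card ≠ 1 → ∃ t t' : G, gface c hc2 Ψ t t' ∈ L ∧
      pot (bd c g n (oflipCM c hc2 t Ψ)) < pot (bd c g n Ψ) ∧ pot (bd c g n (oflipCM c hc2 t' Ψ)) < pot (bd c g n Ψ) ∧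
      pot (bd c g n (oflipCM c hc2 t (oflipCM c hc2 t' Ψ))) < pot (bd c g n Ψ))
    (k : ℕ) (y : CMF G c →₀ ℤ) (hy : ∀ Ψ ∈ y.support, (bd c g n Ψ).card = 1 ∨ pot (bd c g n Ψ) < k + 1) :
    ∃ y' : CMF G c →₀ ℤ, y - y' ∈ L ∧ ∀ Ψ ∈ y'.support, (bd c g n Ψ).card = 1 ∨ pot (bd c g n Ψ) < k := by
  classical
  -- a relation `[Ψ] + w` through each non-singleton type of potential `k`, with `w` invisible at potential `≥ k`
  have hF : ∀ Ψ : CMF G c, (bd c g n Ψ).card ≠ 1 → ∃ v : CMF G c →₀ ℤ, v ∈ L ∧ ∃ w : CMF G c →₀ ℤ,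
      (∀ Φ : CMF G c, pot (bd c g n Ψ) ≤ pot (bd c g n Φ) → w Φ = 0) ∧ v = Finsupp.single Ψ 1 + w := by
    intro Ψ hΨ
    obtain ⟨t, t', hv, h₁, h₂, h₃⟩ := hL Ψ hΨ
    refine ⟨_, hv, Finsupp.single (oflipCM c hc2 t (oflipCM c hc2 t' Ψ)) 1 - Finsupp.single (oflipCM c hc2 t Ψ) 1 -
      Finsupp.single (oflipCM c hc2 t' Ψ) 1, fun Φ hΦ => ?_, by rw [gface]; abel⟩
    have n1 : oflipCM c hc2 t Ψ ≠ Φ := by rintro rfl; omega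
    have n2 : oflipCM c hc2 t' Ψ ≠ Φ := by rintro rfl; omega
    have n3 : oflipCM c hc2 t (oflipCM c hc2 t' Ψ) ≠ Φ := by rintro rfl; omega
    simp only [Finsupp.sub_apply, Finsupp.single_apply, if_neg n1, if_neg n2, if_neg n3, sub_zero]
  choose! F hFmem W hW hFeq using hF
  set B : Finset (CMF G c) := y.support.filter fun Ψ => (bd c g n Ψ).card ≠ 1 ∧ pot (bd c g n Ψ) = k with hB
  set q : CMF G c →₀ ℤ := ∑ Ψ ∈ B, y Ψ • F Ψ with hq
  have hqmem : q ∈ L := Submodule.sum_mem _ fun Ψ hΨ => Submodule.smul_mem _ _ (hFmem Ψ (Finset.mem_filter.mp hΨ).2.1)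
  -- values of `q` at non-singleton types of potential `≥ k`
  have hqval : ∀ Φ : CMF G c, (bd c g n Φ).card ≠ 1 → k ≤ pot (bd c g n Φ) → q Φ = if Φ ∈ B then y Φ else 0 := by
    intro Φ hΦ1 hΦk
    rw [hq, Finsupp.finsetSum_apply]
    have hterm : ∀ Ψ ∈ B, (y Ψ • F Ψ) Φ = if Φ = Ψ then y Ψ else 0 := by
      intro Ψ hΨ
      obtain ⟨-, hΨ1, hΨk⟩ := Finset.mem_filter.mp hΨ
      rw [Finsupp.smul_apply, smul_eq_mul, hFeq Ψ hΨ1, Finsupp.add_apply, hW Ψ hΨ1 Φ (by omega), add_zero,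
        Finsupp.single_apply]
      by_cases h : Ψ = Φ
      · rw [if_pos h, if_pos h.symm, mul_one]
      · rw [if_neg h, if_neg (fun h' => h h'.symm), mul_zero]
    rw [Finset.sum_congr rfl hterm, Finset.sum_ite_eq]
  refine ⟨y - q, by rw [sub_sub_cancel]; exact hqmem, fun Φ hΦ => ?_⟩
  by_contra hbad
  push Not at hbad
  obtain ⟨hΦ1, hΦk⟩ := hbad
  rw [Finsupp.mem_support_iff, Finsupp.sub_apply, hqval Φ hΦ1 hΦk] at hΦ
  by_cases hB' : Φ ∈ B
  · rw [if_pos hB', sub_self] at hΦ; exact hΦ rfl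
  · rw [if_neg hB', sub_zero] at hΦ
    have hsupp : Φ ∈ y.support := Finsupp.mem_support_iff.mpr hΦ
    rcases hy Φ hsupp with h | h
    · exact hΦ1 h
    · exact hB' (Finset.mem_filter.mpr ⟨hsupp, hΦ1, by omega⟩)

/-- **THE DESCENT.**  Modulo such an `L`, every vector is congruent to one supported on types with singleton boundary sets. [folklore] -/
theorem descent (hc2 : c * c = 1) (L : Submodule ℤ (CMF G c →₀ ℤ))
    (hL : ∀ Ψ : CMF G c, (bd c g n Ψ).card ≠ 1 → ∃ t t' : G, gface c hc2 Ψ t t' ∈ L ∧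
      pot (bd c g n (oflipCM c hc2 t Ψ)) < pot (bd c g n Ψ) ∧ pot (bd c g n (oflipCM c hc2 t' Ψ)) < pot (bd c g n Ψ) ∧
      pot (bd c g n (oflipCM c hc2 t (oflipCM c hc2 t' Ψ))) < pot (bd c g n Ψ))
    (y : CMF G c →₀ ℤ) : ∃ y' : CMF G c →₀ ℤ, y - y' ∈ L ∧ ∀ Ψ ∈ y'.support, (bd c g n Ψ).card = 1 := by
  suffices h : ∀ k : ℕ, ∀ y : CMF G c →₀ ℤ, (∀ Ψ ∈ y.support, (bd c g n Ψ).card = 1 ∨ pot (bd c g n Ψ) < k) →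
      ∃ y' : CMF G c →₀ ℤ, y - y' ∈ L ∧ ∀ Ψ ∈ y'.support, (bd c g n Ψ).card = 1 by
    refine h (n * (n * n + 1) + n * n + 1) y fun Ψ _ => Or.inr ?_
    have hc : (bd c g n Ψ).card ≤ n := le_trans (Finset.card_le_univ _) (by rw [ZMod.card])
    have := W_le (bd c g n Ψ)
    unfold pot
    have h1 := Nat.mul_le_mul_right (n * n + 1) hc
    omega
  intro k
  induction k with
  | zero =>
    intro y hy
    exact ⟨y, by rw [sub_self]; exact Submodule.zero_mem _, fun Ψ hΨ => (hy Ψ hΨ).resolve_right (Nat.not_lt_zero _)⟩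
  | succ k ih =>
    intro y hy
    obtain ⟨y₁, h₁, hy₁⟩ := clear_step c g hc2 L hL k y hy
    obtain ⟨y₂, h₂, hy₂⟩ := ih y₁ hy₁
    exact ⟨y₂, by rw [show y - y₂ = (y - y₁) + (y₁ - y₂) from by abel]; exact Submodule.add_mem _ h₁ h₂, hy₂⟩

/-! ## §3 The residue: Hodge vectors on singleton-boundary types are sums of pairs -/

omit [Fintype G] [DecidableEq G] [NeZero n] in
/-- `c` is central in `G = ⟨g⟩`. [folklore] -/
theorem hcen_of_gen (hgn : g ^ n = c) (hgen : ∀ x : G, x ∈ Submonoid.powers g) : ∀ x : G, x * c = c * x := by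
  intro x
  obtain ⟨m, rfl⟩ := (Submonoid.mem_powers_iff _ _).mp (hgen x)
  exact pow_mul_c c g hgn m

omit [NeZero n] in
/-- The type sum as a sum over the support. [folklore] -/
theorem typeSum_apply_eq_sum (y : CMF G c →₀ ℤ) (x : G) : typeSum G c y x = ∑ Φ ∈ y.support, y Φ * indG Φ.1 x := by
  unfold typeSum
  rw [Finsupp.lsum_apply, Finsupp.sum, Finset.sum_apply]
  refine Finset.sum_congr rfl fun Φ _ => ?_
  rw [LinearMap.toSpanSingleton_apply, Pi.smul_apply, smul_eq_mul]

omit [NeZero n] in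
/-- A type is not its own conjugate. [folklore] -/
theorem rt_self_ne (Ψ : CMF G c) : rt c c Ψ ≠ Ψ := by
  intro h
  have h1 : (1 : G) ∈ (rt c c Ψ).1 ↔ (1 : G) ∈ Ψ.1 := by rw [h]
  rw [mem_rt, one_mul] at h1
  have h2 := Ψ.2 1
  rw [mul_one] at h2
  tauto

/-- **THE RESIDUE.**  A vector with constant type sum supported on types with singleton boundary sets lies in `ℤ⟨pairs⟩`. [folklore] -/
theorem mem_span_pairSet_of_card_bd_eq_one (hgn : g ^ n = c) (hgen : ∀ x : G, x ∈ Submonoid.powers g) (y : CMF G c →₀ ℤ)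
    (hk : ∃ k : ℤ, ∀ x : G, typeSum G c y x = k)
    (hsupp : ∀ Ψ ∈ y.support, (bd c g n Ψ).card = 1) : y ∈ Submodule.span ℤ (pairSet c) := by
  classical
  have hcen := hcen_of_gen c g hgn hgen
  suffices h : ∀ N : ℕ, ∀ y : CMF G c →₀ ℤ, (∃ k : ℤ, ∀ x : G, typeSum G c y x = k) →
      (∀ Ψ ∈ y.support, (bd c g n Ψ).card = 1) → y.support.card ≤ N → y ∈ Submodule.span ℤ (pairSet c) from
    h _ y hk hsupp le_rfl
  intro N
  induction N with
  | zero =>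
    intro y _ _ hN
    have h0 : y.support = ∅ := Finset.card_eq_zero.mp (Nat.le_zero.mp hN)
    rw [Finsupp.support_eq_empty] at h0
    rw [h0]; exact Submodule.zero_mem _
  | succ N ih =>
    intro y hk hsupp hN
    by_cases hy0 : y.support.card ≤ N
    · exact ih y hk hsupp hy0
    obtain ⟨Ψ₀, hΨ₀⟩ : y.support.Nonempty := Finset.card_pos.mp (by omega)
    obtain ⟨k₀, hk₀⟩ := Finset.card_eq_one.mp (hsupp Ψ₀ hΨ₀)
    obtain ⟨k, hk⟩ := hk
    -- the key identity `y Ψ₀ = y Ψ̄₀`: compare the type sums at `g^j`, `g^{j+1}` across the unique boundary `j = k₀` of `Ψ₀`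
    have hkey : y Ψ₀ = y (rt c c Ψ₀) := by
      set b : CMF G c → ℤ := fun Φ => indG Φ.1 (g ^ k₀.val) - indG Φ.1 (g ^ (k₀.val + 1)) with hb
      have hD : ∑ Φ ∈ y.support, y Φ * b Φ = 0 := by
        have e : ∑ Φ ∈ y.support, y Φ * b Φ = typeSum G c y (g ^ k₀.val) - typeSum G c y (g ^ (k₀.val + 1)) := by
          rw [typeSum_apply_eq_sum, typeSum_apply_eq_sum, ← Finset.sum_sub_distrib]
          exact Finset.sum_congr rfl fun Φ _ => by rw [hb]; ring
        rw [e, hk, hk, sub_self]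
      have hbval : ∀ Φ : CMF G c, b Φ ≠ 0 ↔ k₀ ∈ bd c g n Φ := by
        intro Φ
        rw [mem_bd_iff, hb]
        simp only [indG]
        by_cases h1 : g ^ k₀.val ∈ Φ.1 <;> by_cases h2 : g ^ (k₀.val + 1) ∈ Φ.1 <;> simp [h1, h2]
      have hb0 : ∀ Φ ∈ y.support, Φ ≠ Ψ₀ → Φ ≠ rt c c Ψ₀ → b Φ = 0 := by
        intro Φ hΦ hne hne'
        by_contra hbΦ
        have hmem := (hbval Φ).mp hbΦ
        obtain ⟨k₁, hk₁⟩ := Finset.card_eq_one.mp (hsupp Φ hΦ)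
        rw [hk₁, Finset.mem_singleton] at hmem
        have heq : bd c g n Ψ₀ = bd c g n Φ := by rw [hk₁, hk₀, hmem]
        rcases eq_or_eq_rt_of_bd_eq c g hgn hgen heq with h | h
        · exact hne h
        · exact hne' h
      have hbbar : b (rt c c Ψ₀) = -b Ψ₀ := by
        simp only [hb, indG, mem_rt, pow_mul_c c g hgn, c_mul_pow_mem_iff c g hgn]
        by_cases h1 : g ^ k₀.val ∈ Ψ₀.1 <;> by_cases h2 : g ^ (k₀.val + 1) ∈ Ψ₀.1 <;> simp [h1, h2]
      have hbΨ₀ : b Ψ₀ ≠ 0 := (hbval Ψ₀).mpr (by rw [hk₀]; exact Finset.mem_singleton_self _)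
      -- split the vanishing sum: only `Ψ₀` and `Ψ̄₀` contribute
      rw [← Finset.add_sum_erase _ _ hΨ₀] at hD
      have hrest : ∑ Φ ∈ y.support.erase Ψ₀, y Φ * b Φ =
          ∑ Φ ∈ y.support.erase Ψ₀, (if Φ = rt c c Ψ₀ then y Φ * b Φ else 0) := by
        refine Finset.sum_congr rfl fun Φ hΦ => ?_
        by_cases h : Φ = rt c c Ψ₀
        · rw [if_pos h]
        · rw [if_neg h, hb0 Φ (Finset.mem_of_mem_erase hΦ) (Finset.ne_of_mem_erase hΦ) h, mul_zero]
      rw [hrest, Finset.sum_ite_eq'] at hD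
      by_cases hmem : rt c c Ψ₀ ∈ y.support.erase Ψ₀
      · rw [if_pos hmem, hbbar] at hD
        have h0 : (y Ψ₀ - y (rt c c Ψ₀)) * b Ψ₀ = 0 := by linear_combination hD
        rcases mul_eq_zero.mp h0 with h | h
        · linear_combination h
        · exact absurd h hbΨ₀
      · rw [if_neg hmem, add_zero] at hD
        rcases mul_eq_zero.mp hD with h | h
        · exact absurd h (Finsupp.mem_support_iff.mp hΨ₀)
        · exact absurd h hbΨ₀
    -- peel off the pair through `Ψ₀`
    set y₁ : CMF G c →₀ ℤ := y - y Ψ₀ • pair c Ψ₀ with hy₁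
    have hy₁apply : ∀ Φ : CMF G c,
        y₁ Φ = y Φ - y Ψ₀ * ((if Ψ₀ = Φ then 1 else 0) + (if rt c c Ψ₀ = Φ then 1 else 0)) := by
      intro Φ
      rw [hy₁, Finsupp.sub_apply, Finsupp.smul_apply, pair, Finsupp.add_apply, Finsupp.single_apply, Finsupp.single_apply,
        smul_eq_mul]
    have hy₁supp : y₁.support ⊆ y.support.erase Ψ₀ := by
      intro Φ hΦ
      rw [Finsupp.mem_support_iff, hy₁apply] at hΦ
      rw [Finset.mem_erase, Finsupp.mem_support_iff]
      by_cases h1 : Ψ₀ = Φ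
      · exfalso; apply hΦ
        rw [if_pos h1, if_neg (fun h2 => rt_self_ne c Ψ₀ (h2.trans h1.symm)), ← h1]; ring
      · by_cases h2 : rt c c Ψ₀ = Φ
        · exfalso; apply hΦ
          rw [if_neg h1, if_pos h2, ← h2, ← hkey]; ring
        · rw [if_neg h1, if_neg h2] at hΦ
          exact ⟨fun h => h1 h.symm, fun h0 => hΦ (by rw [h0]; ring)⟩
    have hy₁mem : y₁ ∈ Submodule.span ℤ (pairSet c) := by
      refine ih y₁ ⟨k - y Ψ₀, fun x => ?_⟩ (fun Ψ hΨ => hsupp Ψ (Finset.mem_of_mem_erase (hy₁supp hΨ))) ?_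
      · rw [hy₁, map_sub, map_smul, Pi.sub_apply, Pi.smul_apply, hk, Census.Coinvariant.typeSum_pair c hcen, smul_eq_mul, mul_one]
      · have := Finset.card_le_card hy₁supp
        rw [Finset.card_erase_of_mem hΨ₀] at this
        omega
    have e : y = y₁ + y Ψ₀ • pair c Ψ₀ := by rw [hy₁]; abel
    rw [e]
    exact Submodule.add_mem _ hy₁mem (Submodule.smul_mem _ _ (Submodule.subset_span (pair_mem_pairSet c Ψ₀)))

end Generator

end

end Summit.HodgeConjecture.CorCM.Census.CyclicFaces
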